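import Literature.AlgebraicGeometry.Milne1999.CMHodgeHypothesisFromRealisations
import Literature.AlgebraicGeometry.HodgeTheory.IsoTransport
import Literature.AlgebraicGeometry.HodgeTheory.HodgeFiltrationModelsReductionProofs
import Literature.AlgebraicGeometry.Motives.CurveNet
import Mathlib.AlgebraicGeometry.Morphisms.ClosedImmersion
import Summits.HodgeConjecture.HodgeConjecture.Theses.RankFourFaces
import HarnessLib

/-!
# COR-CM model universe, construction 2 (model-2): the ISO-COMPLETE Picard–CM index type and its
# kernel junction with Milne's hypothesis (H) = `RankFourFaces.CMAbelianHodge`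

PURPOSE (packaging for the COR-CM cell `pub-hodgecm2`, model-universe builder 2; no mathematical
claim of its own beyond the junction theorem, which is pure transport). The stage-1 Picard–CM model
universe (`PicardCM.Var`, file `Literature/NumberTheory/Automorphic/PicardCMUniverse.lean`) indexes
compact Picard modular surfaces and CM abelian varieties BY CODE, projective spaces and binary
products; its universe reading of "the Hodge conjecture for every CM abelian variety of the universe"
is `Milne1999.CodesHC`, and the passage to Milne's hypothesis (H) over ALL complex abelian varieties
of CM-type needs the binders `hDom` (CM domination by realised codes up to isogeny) and `hIso`
(isogeny invariance) of `Milne1999/CMHodgeHypothesisFromRealisations`.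

This file gives the SECOND construction of the index type, technique-distinct on the index/junction
axis: the same four constructors with the SAME realisations (`pmsRealisation hU`,
`cmRealisation h₃`) — so that every period statement read on Picard and CM codes is literally the
stage-1 one — plus ONE constructor `emb (c : EmbCode)`, an **embedded smooth projective variety**:
a quasi-coherent ideal sheaf `I` of some `ℙᴺ_ℂ` (Mathlib `Scheme.IdealSheafData`, a SMALL type)
whose closed subscheme `V(I) ⊂ ℙᴺ_ℂ` is smooth projective of a recorded dimension `n`. By Mathlib's
scheme-theoretic image (`Scheme.Hom.toImage`, an isomorphism for a closed immersion) EVERY smooth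
projective `X/ℂ` is `ℂ`-isomorphic to the interpretation of such a code (`EmbCode.exists_iso`), so the
universe is COMPLETE UP TO ISOMORPHISM. The content predicates are INTRINSIC: a code is (CM-)abelian
iff its interpretation is `ℂ`-isomorphic to the variety of a complex abelian variety (of CM-type in the
sense of the tree's `Milne1999.IsOfCMType` = the hypothesis of `RankFourFaces.CMAbelianHodge`).

CONSEQUENCE (the junction, KERNEL, no binder): the universe reading `CodesHC₂ hHD hU h₃` of "HC for
every CM abelian variety of the universe" is EQUIVALENT to Milne's hypothesis
`∀ A, Milne1999.CMHodgeHypothesisAt A` (`codesHC₂_iff_forall_cmHodgeHypothesisAt`), granted only the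
tree THEOREM `hI : hodgePQ_independent_of_hodgeModel` (model-independence of `H^{p,q}`, discharged
`hodgePQ_independent_of_hodgeModel_holds`) used by the comparison lemma
`Milne1999.hodgeClasses_le_ratAlgebraicClasses_iff_hodgeConjectureFor`; transport along the coding
isomorphism is the tree's `HodgeTheory/IsoTransport`. The price is paid where it belongs: the
structural fact "every CM abelian variety is dominated by a product of `A_{(F,Θ)}` over one Galois CM
field" (stage-1 `Fact_cmDominated`, M14) must now be supplied at `emb` codes (companion file).

Nothing is cited; the two hypotheses `hU`, `h₃` are the tree's records (ii-a′), (iii) of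
`PicardCMPrerequisites.lean`, exactly as in `PicardCMUniverse.lean`.
-/

noncomputable section

open CategoryTheory AlgebraicGeometry MonoidalCategory

namespace Summit.HodgeConjecture.CorCM

namespace IsoComplete

open Literature.AlgebraicGeometry.Motives (SchemeOver IsSmoothProjective AbelianVariety
  bettiCohomology projectiveSpace isSmoothProjective_projectiveSpace_holds schemeDim_eq_holds)
open Literature.AlgebraicGeometry.HodgeTheory
open Literature.AlgebraicGeometry.Milne1999 (IsOfCMType CMHodgeHypothesisAt
  hodgeClasses_le_ratAlgebraicClasses_iff_hodgeConjectureFor)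
open Literature.NumberTheory.Automorphic
open Literature.NumberTheory.Automorphic.PicardCM (PicardCode CMCode pmsRealisation cmRealisation
  ratAlgebraicClasses BallQuotientUniformisedDatum CMAbelianVarietyRealised)

/-! ### Codes of embedded smooth projective varieties -/

/-- An **embedded smooth projective variety code**: an ideal sheaf `I` on `ℙᴺ_ℂ` whose closed
subscheme `V(I) → ℙᴺ_ℂ → Spec ℂ` is a smooth projective (geometrically integral) variety of
dimension `n`. A small type (`Scheme.IdealSheafData` of a `Scheme.{0}` lives in `Type`). [folklore] -/
structure EmbCode : Type where
  /-- The ambient projective space is `ℙᴺ_ℂ`. -/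
  N : ℕ
  /-- The dimension of the subvariety. -/
  n : ℕ
  /-- The quasi-coherent ideal sheaf cutting out the subvariety. -/
  I : (projectiveSpace N ℂ).left.IdealSheafData
  /-- `V(I)` is smooth projective of dimension `n` over `ℂ`. -/
  isSmoothProjective :
    IsSmoothProjective n (Over.mk (I.subschemeι ≫ (projectiveSpace N ℂ).hom) : SchemeOver ℂ)

namespace EmbCode

/-- The interpretation of an embedded code: the closed subscheme `V(I) ⊂ ℙᴺ_ℂ` as a `ℂ`-scheme.
[folklore] -/
def scheme (c : EmbCode) : SchemeOver ℂ :=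
  Over.mk (c.I.subschemeι ≫ (projectiveSpace c.N ℂ).hom)

/-- The interpretation of an embedded code is smooth projective of the recorded dimension.
[folklore] -/
theorem isSmoothProjective_scheme (c : EmbCode) : IsSmoothProjective c.n c.scheme :=
  c.isSmoothProjective

/-- **Completeness up to isomorphism.** Every smooth projective `X/ℂ` of dimension `n` is
`ℂ`-isomorphic to the interpretation of an embedded code of dimension `n`: a closed immersion
`ι : X ↪ ℙᴺ_ℂ` factors as an ISOMORPHISM onto its scheme-theoretic image `V(ker ι)` (Mathlib:
`IsIso ι.toImage` for a closed immersion) followed by the inclusion. [folklore] -/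
theorem exists_iso {n : ℕ} {X : SchemeOver ℂ} (hX : IsSmoothProjective n X) :
    ∃ c : EmbCode, c.n = n ∧ Nonempty (X ≅ c.scheme) := by
  obtain ⟨N, ι, hι⟩ := hX.isProjectiveOver
  haveI := hι
  let e₀ := asIso ι.left.toImage
  let e : X ≅ (Over.mk (ι.left.ker.subschemeι ≫ (projectiveSpace N ℂ).hom) : SchemeOver ℂ) :=
    Over.isoMk e₀ (by
      change ι.left.toImage ≫ ι.left.imageι ≫ (projectiveSpace N ℂ).hom = X.hom
      rw [Scheme.Hom.toImage_imageι_assoc]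
      exact Over.w ι)
  exact ⟨⟨N, n, ι.left.ker, hX.of_iso e⟩, rfl, ⟨e⟩⟩

end EmbCode

/-! ### The iso-complete index type and its interpretation -/

/-- **The small index type of the iso-complete Picard–CM universe**: compact Picard modular
surfaces (by code), CM abelian varieties (by code), projective spaces `ℙⁿ_ℂ`, embedded smooth
projective varieties (by ideal sheaf), and binary products. [folklore] -/
inductive Var : Type
  /-- the compact Picard modular surface of a Picard code -/
  | pms (c : PicardCode)
  /-- the CM abelian variety of a CM code -/
  | cm (c : CMCode)
  /-- projective `n`-space -/
  | proj (n : ℕ)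
  /-- an embedded smooth projective variety `V(I) ⊂ ℙᴺ_ℂ` -/
  | emb (c : EmbCode)
  /-- binary product -/
  | prod (v w : Var)

namespace Var

/-- The dimension of (the interpretation of) a code. [folklore] -/
def dim : Var → ℕ
  | pms _ => 2
  | cm c => Module.finrank ℚ c.E / 2
  | proj n => n
  | emb c => c.n
  | prod v w => v.dim + w.dim

/-- An embedded code has its recorded dimension (by definition). [folklore] -/
@[simp] theorem dim_emb (c : EmbCode) : (emb c).dim = c.n := rfl
/-- Dimensions add in products (by definition). [folklore] -/
@[simp] theorem dim_prod (v w : Var) : (prod v w).dim = v.dim + w.dim := rfl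

variable (hU : BallQuotientUniformisedDatum) (h₃ : CMAbelianVarietyRealised)

/-- **Interpretation** by schemes over `ℂ` under (ii-a′) and (iii): the realised surface, the realised
abelian variety (the SAME choices as `PicardCM.Var.scheme`), `ℙⁿ_ℂ`, the embedded subvariety, and
the product over `Spec ℂ`. [folklore] -/
def scheme : Var → SchemeOver ℂ
  | pms c => (pmsRealisation hU c).X
  | cm c => (cmRealisation h₃ c).A
  | proj n => projectiveSpace n ℂ
  | emb c => c.scheme
  | prod v w => scheme v ⊗ scheme w

/-- The scheme of `pms c` is the realising surface (by definition). [folklore] -/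
@[simp] theorem scheme_pms (c : PicardCode) : scheme hU h₃ (pms c) = (pmsRealisation hU c).X := rfl
/-- The scheme of `cm c` is the realising abelian variety (by definition). [folklore] -/
@[simp] theorem scheme_cm (c : CMCode) : scheme hU h₃ (cm c) = (cmRealisation h₃ c).A := rfl
/-- The scheme of `proj n` is `ℙⁿ_ℂ` (by definition). [folklore] -/
@[simp] theorem scheme_proj (n : ℕ) : scheme hU h₃ (proj n) = projectiveSpace n ℂ := rfl
/-- The scheme of `emb c` is the embedded subvariety `V(I)` (by definition). [folklore] -/
@[simp] theorem scheme_emb (c : EmbCode) : scheme hU h₃ (emb c) = c.scheme := rfl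
/-- The scheme of a product is the fibre product over `ℂ` (by definition). [folklore] -/
@[simp] theorem scheme_prod (v w : Var) :
    scheme hU h₃ (prod v w) = (scheme hU h₃ v ⊗ scheme hU h₃ w) := rfl

/-- The interpretation agrees with the stage-1 one on Picard codes (definitional). [folklore] -/
theorem scheme_pms_eq (c : PicardCode) : scheme hU h₃ (pms c) = PicardCM.Var.scheme hU h₃ (.pms c) :=
  rfl

/-- The interpretation agrees with the stage-1 one on CM codes (definitional). [folklore] -/
theorem scheme_cm_eq (c : CMCode) : scheme hU h₃ (cm c) = PicardCM.Var.scheme hU h₃ (.cm c) := rfl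

/-- **Every variety of the universe is smooth projective of dimension `dim`.** [folklore] -/
theorem isSmoothProjective : ∀ v : Var, IsSmoothProjective v.dim (scheme hU h₃ v)
  | pms c => (pmsRealisation hU c).isSmoothProjective
  | cm c => (cmRealisation h₃ c).isSmoothProjective
  | proj n => isSmoothProjective_projectiveSpace_holds ℂ n
  | emb c => c.isSmoothProjective_scheme
  | prod v w => Literature.AlgebraicGeometry.Motives.IsSmoothProjective.tensor_holds
      (isSmoothProjective v) (isSmoothProjective w)

/-- **Completeness up to isomorphism** of the universe: every smooth projective `X/ℂ` of dimension
`n` is `ℂ`-isomorphic to the interpretation of a code of dimension `n`. [folklore] -/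
theorem exists_iso {n : ℕ} {X : SchemeOver ℂ} (hX : IsSmoothProjective n X) :
    ∃ v : Var, v.dim = n ∧ Nonempty (X ≅ scheme hU h₃ v) := by
  obtain ⟨c, hc, he⟩ := EmbCode.exists_iso hX
  exact ⟨emb c, hc, he⟩

/-- **Rational cohomology** `Hᵏ(X(ℂ); ℚ)` of a variety of the universe. [folklore] -/
abbrev Coh (v : Var) (k : ℕ) : Type := bettiCohomology (scheme hU h₃ v) k

/-- **Algebraic classes**: the rational algebraic classes of the interpretation. [folklore] -/
abbrev alg (v : Var) (p : ℕ) : Submodule ℚ (Coh hU h₃ v (2 * p)) :=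
  ratAlgebraicClasses (scheme hU h₃ v) p

/-- `Hᵏ(X(ℂ); ℚ)` is finite-dimensional. [folklore] -/
theorem finite (v : Var) (k : ℕ) : Module.Finite ℚ (Coh hU h₃ v k) :=
  finiteDimensional_bettiCohomology (isSmoothProjective hU h₃ v) k

/-- **Morphisms**: `ℂ`-morphisms of the interpretations. [folklore] -/
abbrev Mor (v w : Var) : Type := scheme hU h₃ v ⟶ scheme hU h₃ w

/-- The identity morphism. [folklore] -/
abbrev idMor (v : Var) : Mor hU h₃ v v := 𝟙 _

/-- Composition of morphisms (diagrammatic order). [folklore] -/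
abbrev comp {u v w : Var} (f : Mor hU h₃ u v) (g : Mor hU h₃ v w) : Mor hU h₃ u w := f ≫ g

/-- The first projection of a product. [folklore] -/
abbrev fst (v w : Var) : Mor hU h₃ (prod v w) v := CartesianMonoidalCategory.fst _ _

/-- The second projection of a product. [folklore] -/
abbrev snd (v w : Var) : Mor hU h₃ (prod v w) w := CartesianMonoidalCategory.snd _ _

/-! ### Intrinsic content predicates -/

/-- **Abelian varieties of the universe** (INTRINSIC content predicate): the interpretation is
`ℂ`-isomorphic to the underlying variety of a complex abelian variety. [folklore] -/
def IsAbelianVariety (v : Var) : Prop :=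
  ∃ A : AbelianVariety ℂ, Nonempty (A.X ≅ scheme hU h₃ v)

/-- **CM abelian varieties of the universe** (INTRINSIC content predicate): the interpretation is
`ℂ`-isomorphic to the underlying variety of a complex abelian variety OF CM-TYPE in the sense of the
tree's `Milne1999.IsOfCMType` (`End⁰(A)` contains a commutative reduced `ℚ`-subalgebra of dimension
`2 dim A` — verbatim the hypothesis of `RankFourFaces.CMAbelianHodge`).
[cite: Milne1999, §2 p. 54] -/
def IsCMAbelianVariety (v : Var) : Prop :=
  ∃ A : AbelianVariety ℂ, IsOfCMType A ∧ Nonempty (A.X ≅ scheme hU h₃ v)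

/-- Every CM abelian variety of the universe is an abelian variety of the universe. [folklore] -/
theorem IsCMAbelianVariety.isAbelianVariety {v : Var} (h : IsCMAbelianVariety hU h₃ v) :
    IsAbelianVariety hU h₃ v := by
  obtain ⟨A, _, hA⟩ := h
  exact ⟨A, hA⟩

/-- **Every complex abelian variety of CM-type IS (up to `ℂ`-isomorphism) a CM abelian variety of the
universe**, at a code of the same dimension. [folklore] -/
theorem exists_isCMAbelianVariety (A : AbelianVariety ℂ) (hA : IsSmoothProjective A.dim A.X)
    (hCM : IsOfCMType A) :
    ∃ v : Var, v.dim = A.dim ∧ IsCMAbelianVariety hU h₃ v ∧ Nonempty (A.X ≅ scheme hU h₃ v) := by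
  obtain ⟨v, hv, he⟩ := exists_iso hU h₃ hA
  exact ⟨v, hv, ⟨A, hCM, he⟩, he⟩

/-- A CM abelian variety of the universe has the dimension of its code: `A.dim = v.dim`. [folklore] -/
theorem IsCMAbelianVariety.dim_eq {v : Var} {A : AbelianVariety ℂ} (e : A.X ≅ scheme hU h₃ v) :
    A.dim = v.dim :=
  schemeDim_eq_holds ((isSmoothProjective hU h₃ v).of_iso e.symm)

end Var

/-! ### The universe reading of Milne's hypothesis (H), and the kernel junction -/

/-- **Milne's p. 72 property read in the iso-complete universe**: for every code `v` flagged CM and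
every `p`, the rational Hodge classes of `BettiUniverse.hodge hHD _ (2p)` on `H²ᵖ` of the
interpretation lie in its rational algebraic classes — symbol for symbol what a universe of varieties
indexed by `CorCM.IsoComplete.Var` with `Coh = bettiCohomology ∘ scheme`, `hodge = BettiUniverse.hodge hHD`,
`alg = Var.alg` calls "the Hodge conjecture for all CM abelian varieties". A PREDICATE (definition;
nothing is asserted). [cite: Milne1999, §7 p. 72] -/
def CodesHC₂ (hHD : exists_isReal_hodgeModel) (hU : BallQuotientUniformisedDatum)
    (h₃ : CMAbelianVarietyRealised) : Prop :=
  ∀ v : Var, Var.IsCMAbelianVariety hU h₃ v →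
    ∀ p : ℕ, (BettiUniverse.hodge hHD (Var.isSmoothProjective hU h₃ v) (2 * p)).hodgeClasses p
      ≤ Var.alg hU h₃ v p

/-- `CodesHC₂` says exactly: `HodgeConjectureFor` holds for the interpretation of every CM-flagged
code (comparison theorem, code by code). [cite: Milne1999, §7 p. 72] -/
theorem codesHC₂_iff_forall_hodgeConjectureFor (hHD : exists_isReal_hodgeModel)
    (hI : hodgePQ_independent_of_hodgeModel) (hU : BallQuotientUniformisedDatum)
    (h₃ : CMAbelianVarietyRealised) :
    CodesHC₂ hHD hU h₃ ↔ ∀ v : Var, Var.IsCMAbelianVariety hU h₃ v →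
      HodgeConjectureFor v.dim (Var.scheme hU h₃ v) :=
  forall_congr' fun v => forall_congr' fun _ =>
    hodgeClasses_le_ratAlgebraicClasses_iff_hodgeConjectureFor hHD hI (Var.isSmoothProjective hU h₃ v)

/-- **THE JUNCTION (kernel, no binder).** In the iso-complete universe, "the Hodge conjecture for
every CM abelian variety of the universe" (`CodesHC₂`) is EQUIVALENT to Milne's hypothesis (H)
`∀ A, CMHodgeHypothesisAt A` (= the Summits item `RankFourFaces.CMAbelianHodge` by `Iff.rfl`): every
complex abelian variety of CM-type is `ℂ`-isomorphic to the interpretation of a CM-flagged code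
(`Var.exists_isCMAbelianVariety`), and `HodgeConjectureFor` is invariant under `ℂ`-isomorphism
(the tree's `HodgeTheory/IsoTransport`). The only input besides the records is the tree THEOREM `hI`
(`hodgePQ_independent_of_hodgeModel_holds`). [cite: Milne1999, §7 p. 72] -/
theorem codesHC₂_iff_forall_cmHodgeHypothesisAt {hHD : exists_isReal_hodgeModel}
    (hI : hodgePQ_independent_of_hodgeModel) {hU : BallQuotientUniformisedDatum}
    {h₃ : CMAbelianVarietyRealised} :
    CodesHC₂ hHD hU h₃ ↔ ∀ A : AbelianVariety ℂ, CMHodgeHypothesisAt A := by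
  -- transport of `HodgeConjectureFor n` along a `ℂ`-isomorphism (both conjuncts travel; the tree's
  -- `HodgeTheory/IsoTransport`; the same three lines as ring 2's `hodgeConjectureFor_iff_of_iso`)
  have hiso : ∀ {X' X : SchemeOver ℂ} (e : X' ≅ X) {n : ℕ},
      HodgeConjectureFor n X' ↔ HodgeConjectureFor n X := by
    intro X' X e n
    rw [hodgeConjectureFor_iff, hodgeConjectureFor_iff]
    exact and_congr (nonempty_hodgeModel_iff_of_iso e)
      (forall_congr' fun p => forall_hodgeClass_mem_algebraicClasses_iff_of_iso e p)
  rw [codesHC₂_iff_forall_hodgeConjectureFor hHD hI hU h₃]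
  constructor
  · intro h A hA hCM
    obtain ⟨v, hv, hvCM, ⟨e⟩⟩ := Var.exists_isCMAbelianVariety hU h₃ A hA hCM
    rw [← hv]
    exact (hiso e).2 (h v hvCM)
  · rintro h v ⟨A, hCM, ⟨e⟩⟩
    have hdim : A.dim = v.dim := Var.IsCMAbelianVariety.dim_eq hU h₃ e
    have hA : IsSmoothProjective A.dim A.X := hdim ▸ (Var.isSmoothProjective hU h₃ v).of_iso e.symm
    exact (hiso e).1 (hdim ▸ h A hA hCM)

/-- **Unconditional form of the junction** (the tree theorem `hodgePQ_independent_of_hodgeModel_holds`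
supplied). [cite: Milne1999, §7 p. 72] -/
theorem codesHC₂_iff_forall_cmHodgeHypothesisAt' {hHD : exists_isReal_hodgeModel}
    {hU : BallQuotientUniformisedDatum} {h₃ : CMAbelianVarietyRealised} :
    CodesHC₂ hHD hU h₃ ↔ ∀ A : AbelianVariety ℂ, CMHodgeHypothesisAt A :=
  codesHC₂_iff_forall_cmHodgeHypothesisAt hodgePQ_independent_of_hodgeModel_holds

/-- **The junction with the E-term BY NAME**: `CodesHC₂ hHD hU h₃` ⟺
`Summit.HodgeConjecture.HodgeConjecture.Theses.RankFourFaces.CMAbelianHodge` (stmt-HodgeConjecture-3052 —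
the stage-2 E-term `HC_CM` of the Hodge ladder and ring 2's hypothesis; Milne's (H) is that item by
`Iff.rfl`). KERNEL: records `hU`, `h₃`, `hHD` as parameters, the tree theorem
`hodgePQ_independent_of_hodgeModel_holds` supplied. [cite: Milne1999, §7 p. 72] -/
theorem codesHC₂_iff_CMAbelianHodge {hHD : exists_isReal_hodgeModel}
    {hU : BallQuotientUniformisedDatum} {h₃ : CMAbelianVarietyRealised} :
    CodesHC₂ hHD hU h₃ ↔ Summit.HodgeConjecture.HodgeConjecture.Theses.RankFourFaces.CMAbelianHodge :=
  codesHC₂_iff_forall_cmHodgeHypothesisAt'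

end IsoComplete

end Summit.HodgeConjecture.CorCM

end
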